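import Literature.AlgebraicGeometry.ModuliOfAbelianVarieties.SiegelFineModuliArtinianLifting
import Literature.AlgebraicGeometry.AbelianSchemes.AbelianSchemeLDeltaOfLambdaGlobal
import Literature.AlgebraicGeometry.AbelianSchemes.AbelianSchemeLiftRelDim
import Summits.HodgeConjecture.HodgeConjecture.Theorems.F11StubG0CoefficientField
import Summits.HodgeConjecture.HodgeConjecture.Theorems.F11StubG1AbelianLift   -- (v0.3) MONO-G1 `stubG1_holds` (F0P1b-p06 (g0) → F0P1c-p05 (g2), C3)
import Summits.HodgeConjecture.HodgeConjecture.Theorems.F11StubG2LineBundleLift -- (v0.3) MONO-G2 `stubG2_holds` (B-p13 (g22) → F0P1c-p02 (g2) twin)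
import HarnessLib

/-!
# FLOOR-0 programme P1, sub-line F-11, GRANDCHILD LINE `F11LiftWithLineBundle` — α1 «the PAIR `(A₀, L^Δ(λ₀))` lifts along a genuine
# small extension of Artinian local `ℚ`-algebras», cut (d2)/G: COEFFICIENT FIELD ⊕ SOME ABELIAN LIFT ⊕ SOME (OTHER) LIFT CARRIES THE BUNDLE
# (line v0.2P = ED. 3P shape: PRINCIPAL small extensions `A ↠ A⧸(t)`, `t ≠ 0`, `𝔪_A·t = 0`, ARBITRARY residue field of characteristic `0`;
# v0.0.1 1e2cd2f5818b385c = the ED. 2′ shape (general `J`, `𝔪_A·J = 0`) of record in the tree until this edition; v0.1 e0761be8 (principal +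
# residue field finite over `ℚ`) PARKED by (R31) — the residue-finite binder lost its only consumer to ★ `CechH1DimOfCharZeroByTransport`;
# WHY PRINCIPAL (F0P1b-p03 (g0) MONO-G2 FIT #0, 2026-08-30T23:20:16Z): the ★ (iii) package — engine p793056, P1a p793421, P1a-B p793563,
# P1b p793584 — is typed over `(e : ↥(J.restrictScalars k) ≃ₗ[k] k)`, i.e. a ONE-dimensional kernel, and for `A` Artinian local with
# `𝔪_A·J = 0` that is exactly `J = (t)`, `t ≠ 0`; smoothness of `𝓜` already reduces to PRINCIPAL small extensions at the PARENT level
# (★ p792836 `SiegelFineModuliArtinianLiftingPrincipal`, p01; polarized form (A2♯)), so the principal letter costs nothing upstream;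
# F0P1b-plan (g0) 2026-08-30; author of the parent line B-p05 (g19); integrator F0P1-plan (g0); registrar B-plan1 (g20); HOME `F0/P1b/Lines/`)

HC_CM is proved only modulo the 7 printed citations until rung 0 closes; nothing here is about HC.  Count-neutral: this line discharges
the stub α1 `stub_liftWithLineBundle` of the F-11 sub-line `Cruxes/HDel/Lines/F11SmoothRoadA.lean` (parent edition ED. 3P = tree ED. 2‴ 80420199d7eba478 with α1
re-lettered to the principal shape below — B-p05 (g19)'s pen), letter VERBATIM as the head `stub_liftWithLineBundle_holds` — ONE currency: the day this file is
sorry-free, an edition of the parent replaces α1's `sorry` by `F11LiftWithLineBundle.stub_liftWithLineBundle_holds g` (one line), exactly the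
F-3 → (M) → (Mc) pattern.  New names live strictly below that head.

THE LINE (three stubs, G0 CLOSED BY NAME over ★ p792666; composition kernel-checked):

  `stub_liftWithLineBundle_holds : α1-letter`
    := `stub_coefficientField` (G0) ▸ `stub_abelianLift` (G1) ▸ `stub_lineBundleLiftOfSomeLift` (G2).

* G0 `stub_coefficientField` — **every Artinian local `ℚ`-algebra has a COEFFICIENT FIELD**: a field `k` with `Algebra k A` such that
  `k → A → A⧸𝔪_A` is onto (Cohen's structure theorem in equicharacteristic `0`, Artinian case: Zorn on the subfields of `A` containing `ℚ`;
  a maximal one maps ONTO the residue field — a transcendental residue class lifts to a unit-generic element, an algebraic one lifts by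
  Hensel's lemma in the nilpotent-hence-complete local ring `A`, the lifted minimal polynomial being separable in characteristic `0`).
  [Matsumura, CRT Thm. 28.3; StacksProject Tag 0323; EGA 0_IV 19.6.1.]  WHY A STUB: the ★ obstruction theory (A3)
  (`Deformation/SmoothAffineDeformationsTrivial|Lifting|Cocycle`, `SmoothSchemeLiftObstructionCocycle`, B-p21 (g20)'s F2/F3a/F3b) is written
  over `k`-ALGEBRAS `A'` (`A' ⊗[k] B₀`), so G1/G2's producers need `A` to be an algebra over a field mapping onto its residue field; stating the
  GENERAL coefficient field once here keeps α1's registered letter (bare `A`) untouched and made B-p05 (g19)'s J2 «ED. 3 residue-finite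
  sharpening» of ★ p769385 / (A2) / α1 / αP UNNECESSARY (J1 «residue field finite over `ℚ` ⇒ coefficient field by `FormallyEtale` lifting»
  is its special case and the fallback road).  Size M (1 file, Mathlib-only, 250–400 l.).
* G1 `stub_abelianLift` — **abelian schemes lift** (unobstructedness + group law): for `A` Artinian local over `ℚ` with a coefficient field
  `k`, `J ≠ ⊤` with `𝔪_A·J = 0`, and an abelian scheme `A₀` of relative dimension `g` over `Spec (A⧸J)`, there are an abelian scheme `X` of
  relative dimension `g` over `Spec A` and a base-change square `G : A₀ → X` of group schemes over `Spec (A⧸J) → Spec A` (★ `IsBaseChangeVia`).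
  [Oort1971] Thm. 2.2.1 (Grothendieck); [MumfordFogartyKirwan1994] Ch. 6 §3 Prop. 6.15; [Illusie FGA-explained Thm. 8.5.23].  Sub-structure
  (words, not stubs — one layer at a time): (i) a SMOOTH lift `X'` of the scheme `A₀.X` exists iff `o(A₀) ∈ Ȟ²(X_s, T_{X_s}) ⊗_k J` vanishes
  ((A3): ★ A3a `SmoothSchemeLiftObstructionCocycle` + ★ F1 + B-p21 F2/F3a ✓/F3b FILES 1–5 (HOME GREEN, lit2 PASS) + F3c dictionary OPEN);
  (iv) `o(A₀) = 0` — THE HEART (J4-(iv), F0P1b-p04 census): `T_{X_s} ≅ 𝒪 ⊗ 𝔱` free, `Ȟ²(X_s,𝒪)` via Künneth/(K½), the class is killed by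
  the group structure ([Oort1971] 2.2.1; [MumfordAV1970] §13-style parity / Hopf argument in char 0); (ii) the group law lifts to `X'` and the
  lift is an abelian scheme in the relation form ((A4b): ★ p789807 `AbelianSchemeLiftRelDim`, ★ `AbelianSchemeLiftRigidity`, HOME
  `AbelianSchemeOfLiftedGroupLaw`/`AbelianSchemeLiftOfLaw` B-p04 (g22), (E) FILE A «section + `μ` lift» B-p01 (g16) SOCKETS 271494af,
  ★ p774879 `MorphismLiftsSquareZeroObstruction`, ★ J6-to-be `MorphismLiftsSquareZeroTorsorDimension`, HOME LACK-3 B-p15).  Size L.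
* G2 `stub_lineBundleLiftOfSomeLift` — **given ANY abelian lift, SOME abelian lift carries the bundle**: with the data of α1 (dual pair `D₀`,
  polarisation `λ₀` with graph `Gr₀`, so `L₀ := Gr₀^*𝒫₀ = L^Δ(λ₀)` is NON-DEGENERATE on the closed fibre) and SOME abelian lift `X₁` of `A₀`
  (G1's output), there is an abelian lift `X` of relative dimension `g` — in general ANOTHER one: the lift is MOVED by a class
  `ξ ∈ Ȟ¹(X_s, T) ⊗ J` — with a rank-one `L` on `X`, rigidified along `ε_X`, and `G^*L ≅ L₀`.  [Oort1971] 2.3.3; [MumfordFogartyKirwan1994]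
  App. 7A p. 235 «the obstruction to lifting the polarization can be killed by changing the lifting of X».  Sub-structure (words): (iii-a) PAIRS
  obstruction — for `X → Spec A` flat proper and a genuine small `J`, a rank-one `L₀` on `X ×_A (A⧸J)` lifts to `X` iff `ob(L₀) ∈ Ȟ²(X_s,𝒪) ⊗ J`
  vanishes (★ `Deformation/InvertibleSheafExtensionsFlatSmallExtension` off the principal-`J` case; J4-(iii), F0P1b-p03 census); (iii-b) MOVE
  LEMMA — replacing `X` by `ξ · X` changes `ob(L₀)` by `ξ ⌣ c₁(L₀)`; (iii-c) COHERENT INPUT — `Ȟ¹(X_s,𝒪) ⊗ Ȟ¹(X_s,𝒪) ↠ Ȟ²(X_s,𝒪)` for an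
  abelian variety over a field of char `0` (J3, F0P1b-p02) and `dφ_{L₀}` iso for non-degenerate `L₀`, so `ξ ↦ ξ ⌣ c₁(L₀)` is ONTO and some
  `ξ` kills `ob(L₀)` — F-11-ONLY capital now (F0P1-plan (g0) 21:40:26Z: F-3 (K) closed by the torsion road); (iii-d) the moved lift is again
  an abelian lift of relative dimension `g` in the relation form (G1's (ii) machinery BY NAME + ★ p789807); (vi) rigidification is free
  (`Pic (Spec A) = 0`, twist by the base pull-back of `ε_X^*L⁻¹`).  Size L.

The finer cut of G1 (into (i)(iv)(ii)) and of G2 (into (iii-a…d)) waits for B-p21 (g20)'s glue-datum DEFs (F3b FILE 2 `deformationGlueDatum`)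
and the two censuses (p03, p04) — words here until then (two layers at most; bricks below the stubs land `--supports stmt-HodgeConjecture-24835`).

`sorry` census: TWO = {`stub_abelianLift`, `stub_lineBundleLiftOfSomeLift`} (G0 `stub_coefficientField` is the ★ theorem
`Theorems/F11StubG0CoefficientField.stubG0_holds`, p792666); `#print axioms stub_liftWithLineBundle_holds` = trio ⊕ `sorryAx`.  Imports ★ only.
-/

/-!
LINE v0.3 «G1-P AND G2-P BY NAME — THE GRANDCHILD IS SORRY-FREE» (F0P1b-plan (g2) (R143) 2026-08-31T01:39Z; bytes F0P1a-p01 (g2); pen F0P1b-plan;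
referee F0P1b-ref1; registrar B-plan1, NO `skeleton check`): = v0.2P b985ff42 with TWO imports and TWO bodies — G1-P `stub_abelianLift :=
Summit.HodgeConjecture.HodgeConjecture.Cruxes.HDel.F11StubG1AbelianLift.stubG1_holds g` (MONO-G1: coefficient-field augmentation ★ p798121 ▸ closed
fibre + principal affine cover ▸ transition data of the flat deformation lifted ▸ [MFK94] Prop. 6.15 relation form; [Hartshorne2010] Thm. 10.2) and
G2-P `stub_lineBundleLiftOfSomeLift := Summit.HodgeConjecture.HodgeConjecture.Cruxes.HDel.F11StubG2LineBundleLift.stubG2_holds g` (MONO-G2: ★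
`AbelianSchemeOver.exists_lineBundleLift_of_lift` — move the abelian lift by `ξ ∈ Ȟ¹(X_s,T)` until it carries `L^Δ(λ₀)`, [MumfordFogartyKirwan1994]
App. 7A, [Oort1971] 2.3.3); statements BYTE-IDENTICAL (declsig G1-P 99fa7c9e, G2-P e7db1ea7); everything else byte-identical.  `sorry` census 2 → 0:
THIS LINE IS SORRY-FREE; head `stub_liftWithLineBundle_holds` (= parent α1-P) = {propext, Classical.choice, Quot.sound}.
HC_CM is proved only modulo the 7 printed citations until rung 0 closes.
-/

noncomputable section

open CategoryTheory CategoryTheory.Limits AlgebraicGeometry IsLocalRing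
open Literature.AlgebraicGeometry.AbelianSchemes Literature.AlgebraicGeometry.ModuliOfAbelianVarieties
  Literature.AlgebraicGeometry.Modules Literature.AlgebraicGeometry.Motives

namespace Summit.HodgeConjecture.CorCM.Cruxes.HypDel.F11LiftWithLineBundle

/-- **stub G0: an Artinian local `ℚ`-algebra has a coefficient field.**  For `A` Artinian local with `Algebra ℚ A` there are a field `k`
and an algebra structure `Algebra k A` whose composite with the residue map `A → A⧸𝔪_A` is SURJECTIVE (hence an isomorphism `k ≅ κ(A)`):
Cohen's structure theorem, equicharacteristic-`0` Artinian case (Zorn on subfields `ℚ ⊆ K ⊆ A`; transcendental residue classes lift to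
unit-generic elements, algebraic ones by Hensel's lemma — `𝔪_A` is nilpotent and minimal polynomials are separable in characteristic `0`).
Special case / fallback road (B-p05 (g19) J1): residue field finite over `ℚ` ⇒ `Algebra.FormallyEtale ℚ κ(A)` ⇒ a section of `residue`.
Size M; why it might fail: it cannot mathematically (Cohen); Lean risk = Hensel for nilpotent (not adic-complete-by-instance) local rings.
[cite: Matsumura1987, Theorem 28.3 (p. 215)] [cite: StacksProject, Tag 0323] -/
theorem stub_coefficientField :
    ∀ (A : Type) [CommRing A] [Algebra ℚ A] [IsArtinianRing A] [IsLocalRing A],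
      ∃ (k : Type) (_ : Field k) (_ : Algebra k A), Function.Surjective (⇑(IsLocalRing.residue A) ∘ ⇑(algebraMap k A)) :=
  Summit.HodgeConjecture.HodgeConjecture.Cruxes.HDel.F11StubG0CoefficientField.stubG0_holds

/-- (v0.3: PROVED BY NAME over `Theorems/F11StubG1AbelianLift` — `stubG1_holds`.)
**stub G1: abelian schemes LIFT along genuine small extensions of Artinian local `ℚ`-algebras with a coefficient field** (they are
unobstructed, and the group law lifts; ED. 3P shape = PRINCIPAL small extensions, arbitrary residue field): for `A` Artinian local over `ℚ`,
`k` a coefficient field of `A`, `t ∈ 𝔪_A`, `t ≠ 0`, `𝔪_A·t = 0`, and `A₀` an abelian scheme of relative dimension `g`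
over `Spec (A⧸(t))`, there are an abelian scheme `X` of relative dimension `g` over `Spec A` and a base-change square `G : A₀ → X` of group
schemes over `Spec (A⧸(t)) → Spec A`.  Road: (i) smooth lift iff `o(A₀) ∈ Ȟ²(X_s,T) ⊗ J` vanishes
((A3) ★ + B-p21 (g20) F2/F3a/F3b); (iv) `o(A₀) = 0` (the heart, char `0`); (ii) the group law lifts and the lift is an abelian scheme in the
relation form ((A4b) ★ p789807, ★ `AbelianSchemeLiftRigidity`, B-p04 (g22), (E) FILE A B-p01 (g16)).  Size L; why it might fail: the (A3) ★
currency is affine-piecewise over `k`-algebras and the F3c dictionary «glued trivialised pieces ↦ a scheme over `Spec A` with a cartesian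
square to `A₀.X`» is OPEN (B-p21 census-lite 72f914f0 §0).
[cite: Oort1971, §2.2 Theorem 2.2.1] [cite: MumfordFogartyKirwan1994, Ch. 6 §3 Proposition 6.15 (p. 124)] -/
theorem stub_abelianLift (g : ℕ) :
    ∀ (A : Type) [CommRing A] [Algebra ℚ A] [IsArtinianRing A] [IsLocalRing A]
      (k : Type) [Field k] [Algebra k A], Function.Surjective (⇑(IsLocalRing.residue A) ∘ ⇑(algebraMap k A)) →
      ∀ (t : A), t ≠ 0 → t ∈ maximalIdeal A → maximalIdeal A * Ideal.span {t} = ⊥ →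
      ∀ (A₀ : AbelianSchemeOver (Spec (.of (A ⧸ Ideal.span {t})))), A₀.IsOfRelDim g →
        ∃ (X : AbelianSchemeOver (Spec (.of A))) (_ : X.IsOfRelDim g) (G : A₀.X.left ⟶ X.X.left),
          A₀.IsBaseChangeVia X (Spec.map (CommRingCat.ofHom (Ideal.Quotient.mk (Ideal.span {t})))) G :=
  -- (v0.3) G1-P BY NAME
  Summit.HodgeConjecture.HodgeConjecture.Cruxes.HDel.F11StubG1AbelianLift.stubG1_holds g

/-- (v0.3: PROVED BY NAME over `Theorems/F11StubG2LineBundleLift` — `stubG2_holds`.)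
**stub G2: given ANY abelian lift, SOME abelian lift carries the Mumford bundle** ([MumfordFogartyKirwan1994] App. 7A p. 235: «the
obstruction … can be killed by changing the lifting of `X`»; [Oort1971] 2.3.3).  With the data of α1 (ED. 3P shape) — `A` Artinian local over `ℚ`,
a coefficient field `k`, a principal small extension `A ↠ A⧸(t)`, `A₀`
of relative dimension `g`, a dual pair `D₀`, a polarisation `λ₀` with graph `Gr₀` (so `L₀ := Gr₀^*𝒫₀ = L^Δ(λ₀)` is non-degenerate on the
closed fibre) — and SOME abelian lift `X₁` of `A₀` in the relation form, there are an abelian lift `X` of relative dimension `g` (in general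
ANOTHER one: moved by a class `ξ ∈ Ȟ¹(X_s,T) ⊗ (t) = Ȟ¹(X_s,T)`), a base-change square `G : A₀ → X`, and a rank-one `L` on `X` rigidified along `ε_X` with
`G^*L ≅ L₀`.  Road: (iii-a) PAIRS obstruction `ob(L₀) ∈ Ȟ²(X_s,𝒪)` = ★ `Deformation/InvertibleSheafExtensionsFlatSmallExtension` AS TYPED (principal kernel
`(t)`, `t·𝔪 = 0` — the ED. 3P shape; likewise the ★ (iii) package p793056 ∕ p793421 ∕ p793563 ∕ p793584 over `J ≃ₗ[k] k`); (iii-b) move lemma `ob ↦ ob + ξ ⌣ c₁(L₀)`; (iii-c) `Ȟ¹(𝒪) ⊗ Ȟ¹(𝒪) ↠ Ȟ²(𝒪)` in char `0` (J3) + «`φ_{L₀}` injective ⇒ onto» over ANY field of characteristic `0` (★ p794950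
`AbelianVarieties/PhiLOntoOfInjective` over ★ `CechH1DimOfCharZeroByTransport`; injectivity = (I2-a)) ⇒ `ξ ↦ ξ ⌣ c₁(L₀)` onto;
(iii-d) the moved lift is an abelian lift (G1's (ii) by name); (vi) rigidification free.  Size L; why it might fail: (iii-b) needs the torsor
of flat lifts and the bundle obstruction in ONE Čech currency on ONE cover (B-p21's `deformationGlueDatum`), not yet ★.
[cite: MumfordFogartyKirwan1994, App. 7A (pp. 234–235)] [cite: Oort1971, §2.3 Lemma 2.3.3] -/
theorem stub_lineBundleLiftOfSomeLift (g : ℕ) :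
    ∀ (A : Type) [CommRing A] [Algebra ℚ A] [IsArtinianRing A] [IsLocalRing A]
      (k : Type) [Field k] [Algebra k A], Function.Surjective (⇑(IsLocalRing.residue A) ∘ ⇑(algebraMap k A)) →
      ∀ (t : A), t ≠ 0 → t ∈ maximalIdeal A → maximalIdeal A * Ideal.span {t} = ⊥ →
      ∀ (A₀ : AbelianSchemeOver (Spec (.of (A ⧸ Ideal.span {t})))) (_ : A₀.IsOfRelDim g) (D₀ : A₀.DualPair) (pol₀ : A₀.Polarization D₀)
        (Gr₀ : A₀.X.left ⟶ A₀.prodLeft D₀.hat) (_ : Gr₀ ≫ pullback.fst A₀.X.hom D₀.hat.X.hom = 𝟙 _)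
        (_ : Gr₀ ≫ pullback.snd A₀.X.hom D₀.hat.X.hom = pol₀.lam.left)
        (X₁ : AbelianSchemeOver (Spec (.of A))) (G₁ : A₀.X.left ⟶ X₁.X.left),
        A₀.IsBaseChangeVia X₁ (Spec.map (CommRingCat.ofHom (Ideal.Quotient.mk (Ideal.span {t})))) G₁ →
        ∃ (X : AbelianSchemeOver (Spec (.of A))) (_ : X.IsOfRelDim g) (G : A₀.X.left ⟶ X.X.left)
          (_ : A₀.IsBaseChangeVia X (Spec.map (CommRingCat.ofHom (Ideal.Quotient.mk (Ideal.span {t})))) G)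
          (L : X.left.Modules) (hL : HasRank L 1)
          (_ : CechPic.pullback X.unitSection (detClass (HasRank.isFiniteLocallyFree' hL)) = 1),
          Nonempty ((Scheme.Modules.pullback G).obj L ≅ (Scheme.Modules.pullback Gr₀).obj D₀.P) :=
  -- (v0.3) G2-P BY NAME
  Summit.HodgeConjecture.HodgeConjecture.Cruxes.HDel.F11StubG2LineBundleLift.stubG2_holds g

/-- **α1 by the line G0 ▸ G1 ▸ G2 — the composition (kernel-checked; v0.3: its three stubs are all closed by name — NO `sorry` in its cone):** the letter of
`F11SmoothRoadA.stub_liftWithLineBundle` (ED. 3P) VERBATIM.  Take a coefficient field (G0), some abelian lift (G1), and move it until it carries the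
bundle (G2). [cite: MumfordFogartyKirwan1994, App. 7A (pp. 234–235)] [cite: Oort1971, §2.2–2.4] -/
theorem stub_liftWithLineBundle_holds (g : ℕ) :
    ∀ (A : Type) [CommRing A] [Algebra ℚ A] [IsArtinianRing A] [IsLocalRing A] (t : A),
      t ≠ 0 → t ∈ maximalIdeal A → maximalIdeal A * Ideal.span {t} = ⊥ →
      ∀ (A₀ : AbelianSchemeOver (Spec (.of (A ⧸ Ideal.span {t})))) (_ : A₀.IsOfRelDim g) (D₀ : A₀.DualPair) (pol₀ : A₀.Polarization D₀)
        (Gr₀ : A₀.X.left ⟶ A₀.prodLeft D₀.hat) (_ : Gr₀ ≫ pullback.fst A₀.X.hom D₀.hat.X.hom = 𝟙 _)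
        (_ : Gr₀ ≫ pullback.snd A₀.X.hom D₀.hat.X.hom = pol₀.lam.left),
        ∃ (X : AbelianSchemeOver (Spec (.of A))) (_ : X.IsOfRelDim g) (G : A₀.X.left ⟶ X.X.left)
          (_ : A₀.IsBaseChangeVia X (Spec.map (CommRingCat.ofHom (Ideal.Quotient.mk (Ideal.span {t})))) G)
          (L : X.left.Modules) (hL : HasRank L 1)
          (_ : CechPic.pullback X.unitSection (detClass (HasRank.isFiniteLocallyFree' hL)) = 1),
          Nonempty ((Scheme.Modules.pullback G).obj L ≅ (Scheme.Modules.pullback Gr₀).obj D₀.P) := by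
  intro A _ _ _ _ t ht0 htm hJ A₀ hA₀ D₀ pol₀ Gr₀ hGr₁ hGr₂
  -- G0: a coefficient field
  obtain ⟨k, _instF, _instA, hk⟩ := stub_coefficientField A
  -- G1: some abelian lift
  obtain ⟨X₁, _hX₁, G₁, hG₁⟩ := stub_abelianLift g A k hk t ht0 htm hJ A₀ hA₀
  -- G2: move it until it carries the bundle
  exact stub_lineBundleLiftOfSomeLift g A k hk t ht0 htm hJ A₀ hA₀ D₀ pol₀ Gr₀ hGr₁ hGr₂ X₁ G₁ hG₁

end Summit.HodgeConjecture.CorCM.Cruxes.HypDel.F11LiftWithLineBundle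

end
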